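import Mathlib
import HarnessLib
import Summits.Ventures.LatticeQCDFlow.Exactness.FlowPushforward
import Summits.Ventures.LatticeQCDFlow.Scaling.EntropyBudgetCoupling
import Summits.Ventures.LatticeQCDFlow.Scaling.EntropyBudgetHaarMoves

/-!
# The kernel coupling layer books the kernel's Jacobian at the loop: `U ↦ h(U S) (U S)⁻¹ U` is exact iff `h` is, by two-sided Haar invariance

HONEST FRAMING: exact (Metropolis-corrected) sampling algorithms for lattice gauge theory;
figures of merit are autocorrelation/cost numbers at stated couplings and volumes; no
continuum-physics claim.

Venture `LatticeQCDFlow` (cell pub-lqcd), topic `Exactness`; FANOUT row 10 (`eng-equiv`, engine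
`latflow.equiv`, `spectral.SUNSpectralCoupling` docstring: "loop `W = U_μ(x) S(x)` with frozen
`S`, `W' = h(W | context)`, `U_μ(x)' = W' W† U_μ(x)`; by left/right invariance of Haar the
Jacobian of `U_μ(x) → U_μ(x)'` equals that of `W → W'`" — the log-det the engine books for a
spectral / `U(1)` plaquette coupling layer is the KERNEL's log-det evaluated at the loop, and
nothing for the staple).  NEW WORK of the cell over row 30's `FlowPushforward.HasJacobian`,
row 31's `Theory2.coupleFun` / `hasJacobian_coupleFun` (coupling layers) and
`Theory2.hasJacobian_mul_mul_inv` (two-sided translations of a compact group are exact with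
Jacobian `1`, from `QuantumLattice.measurePreserving_mul_mul_inv_haarProbability`); nothing is
cited as a fact; no number; no definition is introduced.  Printed counterparts, NAMED ONLY:
Kanwar et al., PRL 125 (2020) 121601 (eq. (13) and the sentence after it); Boyda et al., PRD 103
(2021) 074504 §II.B.

## Content (`G` any compact Hausdorff-measurable group, `μ = haarProbability G`)

* `hasJacobian_translate` — `U ↦ a U b` is exact for `μ` with Jacobian `1`;
* **`hasJacobian_conj_kernel`** — if the kernel `h` is exact for `μ` with Jacobian `J`, then so is
  `U ↦ c · h(a U b) · e` with Jacobian `U ↦ J(a U b)` (`HasJacobian.comp` twice: translations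
  contribute `1`);
* `kernel_update_eq` — the layer's active-link formula `h(P) P⁻¹ U` with `P = U S` IS
  `h(U S) S⁻¹` (any group);
* **`hasJacobian_kernel_update`** — THE SINGLE-LINK STATEMENT: `HasJacobian μ h J` ⟹
  `HasJacobian μ (U ↦ h(U S) (U S)⁻¹ U) (U ↦ J(U S))` for every frozen staple `S` — the Jacobian
  the engine books for the link is the kernel's at the loop;
* **`hasJacobian_kernelCouplingLayer`** — THE LAYER: for a mask `p` on any finite index set of
  links, staples `S a y` and kernels `h a y` read from the FROZEN links `y` with per-kernel
  Jacobian densities `j a y ≥ 0` (`HasJacobian μ (h a y) (ofReal ∘ j a y)`), jointly measurable,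
  the coupling layer `Theory2.coupleFun p (a, y, u ↦ h a y (u · S a y) (u · S a y)⁻¹ u)` is exact
  for `⊗ μ` with Jacobian `∏_active j a y (u_a · S a y)` (`Theory2.coupleJac`) — the
  hypothesis shape of row 31's entropy-budget / exactness theorems for this layer class, reduced
  to the kernel's own certificate (for the `U(1)` NCP / spline kernels: rows 14 / 10,
  `NCPCircleJacobian`, `CircularRQSJacobian`; for the `SU(N)` spectral kernel: the Weyl-formula
  computation of Boyda eq. (19), NOT in the tree).

NOT here: the spectral kernel's own Jacobian (Haar–Vandermonde factor); measurability of the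
engine's concrete staples / conditioners (hypotheses `hψ`, `hj`); any number.
-/

noncomputable section

namespace Summit.Ventures.LatticeQCDFlow.Exactness

open MeasureTheory
open Literature.MathematicalPhysics.QuantumFieldTheory
open scoped ENNReal

variable {G : Type*} [Group G]

/-- **The layer's active-link formula is a translate of the kernel**: with the loop `P = U S`
(link first, then the frozen staple), `h(P) P⁻¹ U = h(U S) S⁻¹` (any group). -/
theorem kernel_update_eq (h : G → G) (U S : G) : h (U * S) * (U * S)⁻¹ * U = h (U * S) * S⁻¹ := by
  rw [mul_inv_rev, mul_assoc, mul_assoc, inv_mul_cancel, mul_one]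

variable [TopologicalSpace G] [IsTopologicalGroup G] [CompactSpace G] [MeasurableSpace G]
  [BorelSpace G]

/-- **Two-sided translations are exact with Jacobian `1`**: `U ↦ a U b` pushes the Haar
probability to itself (`Theory2.hasJacobian_mul_mul_inv`, compact groups are unimodular). -/
theorem hasJacobian_translate (a b : G) :
    HasJacobian (haarProbability G) (fun U => a * U * b) fun _ => 1 := by
  have h := Theory2.hasJacobian_mul_mul_inv (G := G) a b⁻¹
  simp only [inv_inv] at h
  exact h

/-- **A translated kernel has the kernel's Jacobian at the translated argument.**  If `h` is
exact for the Haar probability with Jacobian `J`, then `U ↦ c · h(a U b) · e` is exact with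
Jacobian `U ↦ J(a U b)`. -/
theorem hasJacobian_conj_kernel {h : G → G} {J : G → ℝ≥0∞} (hh : HasJacobian (haarProbability G) h J)
    (a b c e : G) :
    HasJacobian (haarProbability G) (fun U => c * h (a * U * b) * e) fun U => J (a * U * b) := by
  have key := (hasJacobian_translate c e).comp (hh.comp (hasJacobian_translate a b))
  have hJ : (fun z => (1 : ℝ≥0∞) * (J (a * z * b) * 1)) = fun U => J (a * U * b) := by
    funext z
    rw [one_mul, mul_one]
  rw [hJ] at key
  exact key

/-- **THE SINGLE-LINK STATEMENT.**  If the kernel `h` is exact for the Haar probability with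
Jacobian `J`, then the kernel update of a link through the loop `P = U S` with frozen staple `S`,
`U ↦ h(U S) (U S)⁻¹ U`, is exact with Jacobian `U ↦ J(U S)`: the layer books the kernel's
log-det at the loop and nothing for the staple. -/
theorem hasJacobian_kernel_update {h : G → G} {J : G → ℝ≥0∞} (hh : HasJacobian (haarProbability G) h J)
    (S : G) :
    HasJacobian (haarProbability G) (fun U => h (U * S) * (U * S)⁻¹ * U) fun U => J (U * S) := by
  have key := hasJacobian_conj_kernel hh 1 S 1 S⁻¹
  have hf : (fun U => (1 : G) * h (1 * U * S) * S⁻¹) = fun U => h (U * S) * (U * S)⁻¹ * U := by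
    funext U
    rw [one_mul, one_mul, kernel_update_eq]
  have hJ : (fun U => J ((1 : G) * U * S)) = fun U => J (U * S) := by
    funext U
    rw [one_mul]
  rw [hf, hJ] at key
  exact key

/-- The same for a loop read the other way, `P = S U` (staple first): `U ↦ U (S U)⁻¹ h(S U)`,
i.e. `S⁻¹ h(S U)`, is exact with Jacobian `U ↦ J(S U)`. -/
theorem hasJacobian_kernel_update_left {h : G → G} {J : G → ℝ≥0∞}
    (hh : HasJacobian (haarProbability G) h J) (S : G) :
    HasJacobian (haarProbability G) (fun U => U * (S * U)⁻¹ * h (S * U)) fun U => J (S * U) := by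
  have key := hasJacobian_conj_kernel hh S 1 S⁻¹ 1
  have hf : (fun U => S⁻¹ * h (S * U * 1) * 1) = fun U => U * (S * U)⁻¹ * h (S * U) := by
    funext U
    rw [mul_one, mul_one, mul_inv_rev, ← mul_assoc, mul_inv_cancel, one_mul]
  have hJ : (fun U => J (S * U * 1)) = fun U => J (S * U) := by
    funext U
    rw [mul_one]
  rw [hf, hJ] at key
  exact key

/-- **THE LAYER.**  On any finite set of links `ι` with a mask `p`, let each active link `a` carry
a staple `S a y` and a kernel `h a y` computed from the FROZEN links `y`, the kernel being exact
for the Haar probability with density `j a y ≥ 0`, everything jointly measurable in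
(link value, frozen links).  Then the kernel coupling layer — `u_a ↦ h a y (u_a S) (u_a S)⁻¹ u_a`
on active links, identity on frozen ones, i.e. `Theory2.coupleFun p …` — is exact for the
product Haar measure with Jacobian the product over active links of the kernels' densities AT
THE LOOPS (`Theory2.coupleJac`). -/
theorem hasJacobian_kernelCouplingLayer {ι : Type*} [Fintype ι] (p : ι → Prop) [DecidablePred p]
    (S : {i // p i} → ({i // ¬p i} → G) → G) (h : {i // p i} → ({i // ¬p i} → G) → G → G)
    (j : {i // p i} → ({i // ¬p i} → G) → G → ℝ)
    (hψ : ∀ a, Measurable fun q : G × ({i // ¬p i} → G) =>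
      h a q.2 (q.1 * S a q.2) * (q.1 * S a q.2)⁻¹ * q.1)
    (hj : ∀ a, Measurable fun q : G × ({i // ¬p i} → G) => j a q.2 (q.1 * S a q.2))
    (hJ : ∀ a y, HasJacobian (haarProbability G) (h a y) fun g => ENNReal.ofReal (j a y g))
    (hj0 : ∀ a y g, 0 ≤ j a y g) :
    HasJacobian (Measure.pi fun _ : ι => haarProbability G)
      (Theory2.coupleFun p fun a y u => h a y (u * S a y) * (u * S a y)⁻¹ * u)
      fun U => ENNReal.ofReal (Theory2.coupleJac p (fun a y u => j a y (u * S a y)) U) :=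
  haveI : IsProbabilityMeasure (haarProbability G) :=
    ⟨by rw [haarProbability]; exact Measure.haarMeasure_self⟩
  Theory2.hasJacobian_coupleFun (haarProbability G) hψ hj
    (fun a y => hasJacobian_kernel_update (hJ a y) (S a y)) (fun a y g => hj0 a y _)

end Summit.Ventures.LatticeQCDFlow.Exactness
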